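import Summits.QuantumFields.YangMills.Theorems.BalabanUVNodesN08AlphaEq324RowRange
import Summits.QuantumFields.YangMills.Theorems.BalabanUVNodesN08AlphaEq324RowSocket

/-!
# Route «BalabanUVNodes», Track-A DAG node N08 = [Balaban1985UV3] Thm 1 p. 257 ∕ Thm 2 p. 272 — THE CUMULANT LETTER OF THE (3.24) ∕ G3D-02 ROWS IS FREE:
# rows C3∕C4 from ONE `Eq324` row over an ARBITRARY cumulant letter `c`, the range-honest core (α) clause RE-LETTERED (`StepAlphaEq324CoreLTAt … c`),
# its equivalence with the landed clause at the lane's letter `c := (𝔖 ·).cum`, and the supplier socket at the letter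

Cell `pub-ymgap`, seat `pub-ymgap-dag-n08-w4` gen 2 (INTENT-1; sequel of gen 0's lineage p585687 … p594787, in particular `…N08AlphaEq324RowRange` p591132 ✓
and `…N08AlphaEq324RowSocket` p594787 ✓).  `bears_on: R4∕N08`; filed `--supports stmt-QuantumFields-20542` (K1⁷).  Two `Prop`-structures + theorems; def-free,
sorry-free, standard axioms; the lane's `Summits/QuantumFields/Balaban3D/Proofs/*` files and gen 0's files are consumed BY NAME and left untouched.

THE LOCATED POINT ((α)-schema currency point #4).  The lane's printed cumulants are DEFINED as `StepSeries.cum h U n := truncExp (𝒱 h U) (chiMeasure μ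
𝟙_{box h}) n` (`Carriers/StepSeries.lean` :169, ruling R-324) — derivatives at `0` of the cgf of `𝒱` under the χ-WEIGHTED law `χ·dμ_{C^{(k)}}`.  The only supplier
road in the tree — [BenfattoEtAl1978]'s Basic Lemma (tree theorem `B1Eq324BenfattoSect5BasicLemma.basicLemmaPrinted_holds`) and B1's sentence (3.24) at [2]'s
model (`B1Eq324BenfattoModelEq324.eq324_benfatto_model`) — concludes with the FREE cumulants `truncatedExp (P0 d α β) H n = cumulantOf (m ↦ ∫ Hᵐ dP̂₀) n`
(Remark 1 p. 152, no cut-off), as will every class edition of it; and print's G3D-02 sentence «graphs … with lines corresponding to the propagator C^{(k)}»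
([Balaban1985UV3] p. 270; (23) p. 262) is Wick's theorem for the FREE Gaussian measure.  The comparison χ-weighted ↔ free of the first `n̄` cumulants is an
extensive cluster-expansion estimate (dag-n08-d `N08-ALPHA-LOCATED-g7.md` (r12): class II).  THE REPAIR: the lane's composition never reads WHICH cumulants
the rows speak about — `Run3Cumulant.cumulant58_of_graphRep23'` ∕ `Cumulant59.cumulantLower_torus` take the cumulant function as a free argument; `h324` and
`hG` only have to read the SAME `U ↦ Σ_{n≤n̄} c h U n ∕ n!`.
* §1 rows C3∕C4 at `seriesPieces` and at the lane's `pieces` from ONE `Eq324` row + `hG` at an ARBITRARY letter `c : Hist S.P (k+1) → GaugeField S.P (k+1) G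
  → ℕ → ℝ` (`cumulant58∕cumulantLower_series_std_of_eq324_at`, `cumulant58∕cumulantLower_pieces_of_eq324_at`; gen 0's `…RowSuppliers.*_core` = `c := (𝔖 k).cum`).
* §2 the RE-LETTERED range-honest core clause `StepAlphaEq324CoreLTAt 𝔊 𝔠 X 𝔖 𝔄 c k hk` ∕ `RunAlphaEq324CoreLTAt … 𝔄 c` (gen 0's `…RowRange.StepAlphaEq324CoreLT`
  row for row, `hG`∕`h324` reading `c k`); ★ `stepCoreLTAt_cum_iff` ∕ `coreLTAt_cum_iff`: AT THE LANE'S LETTER the two clauses are EQUIVALENT (every inhabitant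
  of the landed one is inherited, nothing is lost); `stepCoreLTAt_congr` (only the orders `1 … n̄` are read).
* §3 the supplier socket at the letter: `h324RowAt_of_abs_log_le`, `h324RowAt_of_eq324_le` (gen 0's `…RowSocket` §2 with `(𝔖 k).cum ↦ c k`).
Sequels: `…RowCumLetterEnd` (END theorems from the re-lettered clause, N08 by name), `…RowCumLetterModel` (the re-lettered row's shape inhabited at [2]'s model).
HONEST SCOPE ∕ A6.  Hypothesis-shape bookkeeping on the Summits side: at `c := (𝔖 ·).cum` the clause IS the landed one (§2); at the free letter it is the shape
the [2]-road supplies.  Nothing of [B10] decided; the identification of B10's step measures with a Gaussian model of the [2]-class (class II) untouched; not a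
defect of any landed module.  Count-neutral; N08 NOT discharged; one finite 𝕋⁴ programme at fixed ε, d = 3 tori of [B10] inside the record, Bałaban AS
PRINTED; nothing about d = 4, the continuum, OS axioms, a mass gap or Clay — R4 closes the conditional finite-𝕋⁴ rung `BalabanLadder.UV` only.

References: [Balaban1985UV3] T. Bałaban, CMP 102 (1985) 255–275 — (23)–(24) p. 262, (56)–(59) p. 270, (37) p. 265; [Balaban1982Higgs1] T. Bałaban, CMP 85
(1982) 603–636 — (3.24) p. 616; [BenfattoEtAl1978] G. Benfatto et al., CMP 59 (1978) 143–166 — Lemma p. 152, Remark 1.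
-/

noncomputable section

namespace Summit.QuantumFields.YangMills.Theorems.BalabanUVNodesN08AlphaEq324RowCumLetter

open MeasureTheory Metric
open scoped BigOperators Nat Matrix.Norms.L2Operator
open Literature.MathematicalPhysics.QuantumFieldTheory.Balaban1983to89
open Literature.MathematicalPhysics.QuantumFieldTheory.Balaban1983to89.B10
open Literature.MathematicalPhysics.QuantumFieldTheory.Balaban1983to89.B10SectAGathering
open Literature.MathematicalPhysics.QuantumFieldTheory.Balaban1983to89.B10SectCExpansion (Bound44)
open Literature.MathematicalPhysics.QuantumFieldTheory.Balaban1983to89.B12TreeDecay (kappa₀ K₀)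
open Literature.MathematicalPhysics.QuantumFieldTheory.Balaban1983to89.TreeLengthTorus (tsys tcubeSys)
open Literature.MathematicalPhysics.QuantumFieldTheory.Balaban1983to89.B1Sect3Statements (Eq324)
open Literature.MathematicalPhysics.QuantumFieldTheory.Balaban1985CMP102
open Literature.MathematicalPhysics.QuantumFieldTheory.Balaban1985CMP102.Setting
open Literature.MathematicalPhysics.QuantumFieldTheory.Balaban1985CMP102.Theorems
open Literature.MathematicalPhysics.QuantumFieldTheory.Balaban1985CMP102.Binders
  (ChartAnalyticityAsCited FarTermsDecayAsCited Norm35StepAsCited LogZTExtensiveAsCited LogZLocalizedAsCited GraphTerms GraphRep23AsCited)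
open Summit.QuantumFields.Balaban3D.Carriers
open Summit.QuantumFields.Balaban3D.Proofs
open Summit.QuantumFields.Balaban3D.Proofs.ScalesArithmetic
open Summit.QuantumFields.Balaban3D.Proofs.Inputs
open Summit.QuantumFields.Balaban3D.Proofs.Primitives
open Summit.QuantumFields.Balaban3D.Proofs.Representation33 (jet26)
open Summit.QuantumFields.Balaban3D.Proofs.Bound55Std (Fibre49 Fibre57Low hint_std hint47_std)
open Summit.QuantumFields.Balaban3D.Proofs.LiftBridge (liftCfg)
open Summit.QuantumFields.Balaban3D.Proofs.Run3SmallFactors (codeZ)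
open Summit.QuantumFields.Balaban3D.Proofs.GroupModelLieC (lieC)
open Summit.QuantumFields.Balaban3D.Proofs.UVStability3DInputs
open Summit.QuantumFields.YangMills.Theorems.BalabanUVNodesN08AlphaEq324RowRange
open Summit.QuantumFields.YangMills.Theorems.BalabanUVNodesN08AlphaEq324RowSocket (eq324_of_abs_log_le eq324_mono)
open B7Prop1Explicit (hol plaqWord)
open B7Prop1Local (pdevOn loK plaqHiK)
open B7Prop2Explicit (avgIter)

variable {L : ℕ}

/-! ## §1 Rows C3∕C4 from ONE `Eq324` row + G3D-02, at an ARBITRARY cumulant letter `c` -/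
section SeriesAt

variable {S : Scales L} {G : Type} [GaugeGroup G] [MeasurableSpace G] [HaarData G]
  {V : Type} [NormedAddCommGroup V] [NormedSpace ℂ V] {Nc : ℕ → ℕ} [∀ k, NeZero (Nc k)]

/-- **Row C3 `Cumulant58` AT `seriesPieces` FROM ONE `Eq324` ROW, AT AN ARBITRARY CUMULANT LETTER `c`** — gen 0's `…RowSuppliers.cumulant58_series_std_of_eq324_core`
with the χ-weighted `(𝔖 k).cum` replaced by any `c h U : ℕ → ℝ` read by BOTH `h324` and `hG` (the composition `Run3Cumulant.cumulant58_of_graphRep23'` only reads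
`U ↦ Σ_{n≤n̄} c h U n∕n!`). [cite: Balaban1985UV3, (24) p.262 + (58)–(59) p.270; Balaban1982Higgs1, (3.24) p.616] -/
theorem cumulant58_series_std_of_eq324_at (B : TowerBase S G) (𝔖 : ∀ k, StepSeries S G V (Nc k) k) (Cp : ∀ k, PiecesParams S k) (k : ℕ)
    [DecidableEq (tsys 3 (𝔖 k).Nblk).Dom] {κ C : ℝ}
    (hκ : kappa₀ (4 * 2 ^ 3) (2 * 3) + 1 ≤ κ) (hC : 0 ≤ C) {C₂₃ c₂₃ M₁ δ₀ : ℝ}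
    (hact : ∀ h X U, ((𝔖 k).Gt h).activities.act X U = (𝔖 k).act h X U) {nbar : ℕ} {C₂ : ℝ}
    (c : Hist S.P (k + 1) → GaugeField S.P (k + 1) G → ℕ → ℝ)
    (h324 : ∀ h (U : GaugeField S.P (k + 1) G),
      Eq324 (∫ ω in (𝔖 k).box h, Real.exp ((𝔖 k).𝒱 h U ω) ∂(𝔖 k).μ) (c h U) nbar C₂ ((L : ℝ) ^ k * S.g0sq) (3 + B.κ₀) (S.sites k))
    (hC₂ : 0 ≤ C₂) (hk : k ≤ S.K) (hκ₀ : 0 < B.κ₀) {r₀ R₁ : ℝ} (hr₀ : 1 ≤ r₀) (hR₁ : 6 + 2 * B.κ₀ ≤ R₁)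
    (hrem : (Cp k).rem = ((L : ℝ) ^ k * S.g0sq) ^ (3 + B.κ₀) * S.sites k)
    (hRret : B.Rret k = R₁ * B10.rFun r₀ (S.gk k))
    (hblocks : ((𝔖 k).Nblk : ℝ) ^ 3 ≤ S.sites k)
    (hG : ∀ h, GraphRep23AsCited ((𝔖 k).Gt h) (fun U => ∑ n ∈ Finset.Icc 1 nbar, c h U n / (n ! : ℝ)) C₂₃ c₂₃ M₁ δ₀)
    (h25 : ∀ h, B10.Bound25Printed
      ⟨(tsys 3 (𝔖 k).Nblk).Dom, GaugeField S.P (k + 1) G, (tsys 3 (𝔖 k).Nblk).dj, (𝔖 k).act h⟩ (S.gk k) κ C) :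
    Cumulant58 (seriesPieces B 𝔖 Cp k) (C * K₀ (4 * 2 ^ 3) (2 * 3)) (0 + C * K₀ (4 * 2 ^ 3) (2 * 3) * Real.exp (-R₁) + C₂) := by
  have hZ : ∀ h, (((Finset.univ : Finset (tcubeSys 3 (𝔖 k).Nblk).Cube) \ ΩblkOf (P := S.P) B.M₁ B.Rcol (Nc k) h).card : ℝ)
      ≤ (seriesPieces B 𝔖 Cp k).Zvol h := fun h => by
    show _ ≤ ((ZVol B.M₁ B.Rcol (k + 1) h k : ℕ) : ℝ)
    exact_mod_cast card_compl_ΩblkOf_le_ZVol (P := S.P) B.M₁ B.Rcol (Nc k) h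
  have hg : 0 < S.gk k := gk_pos S k
  have hg1 : S.gk k ≤ 1 := gk_le_one S S.gK_le_one k hk
  have hK₀ : 0 ≤ K₀ (4 * 2 ^ 3) (2 * 3) := (B12TreeDecay.K₀_pos _ _).le
  have hR : 0 ≤ B.Rret k := by
    rw [hRret]; exact mul_nonneg (by linarith) (VacuumAndBooking.rFun_nonneg r₀ (S.gk k) hg hg1)
  have hlarge : (C * S.gk k * K₀ (4 * 2 ^ 3) (2 * 3) * ((𝔖 k).Nblk : ℝ) ^ 3) * Real.exp (-B.Rret k) ≤
      (C * K₀ (4 * 2 ^ 3) (2 * 3) * Real.exp (-R₁)) * (Cp k).rem := by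
    have h := largeLoc_le_normRem S (r₀ := r₀) (R₁ := R₁) (κ₀ := B.κ₀) (A := C * K₀ (4 * 2 ^ 3) (2 * 3))
      (vol := ((𝔖 k).Nblk : ℝ) ^ 3) k hk hr₀ (by linarith) (by linarith) (mul_nonneg hC hK₀) (by positivity) hblocks
    rw [hRret, hrem, ScalesArithmetic.norm_rem_eq]
    calc C * S.gk k * K₀ (4 * 2 ^ 3) (2 * 3) * ((𝔖 k).Nblk : ℝ) ^ 3 * Real.exp (-(R₁ * B10.rFun r₀ (S.gk k)))
        = C * K₀ (4 * 2 ^ 3) (2 * 3) * S.gk k * ((𝔖 k).Nblk : ℝ) ^ 3 * Real.exp (-(R₁ * B10.rFun r₀ (S.gk k))) := by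
          ring
      _ ≤ C * K₀ (4 * 2 ^ 3) (2 * 3) * Real.exp (-R₁) * ((S.gk k ^ 2) ^ (3 + B.κ₀) * S.sites k) := h
  have hlogFl : ∀ (h : Hist S.P (k + 1)) (U : GaugeField S.P (k + 1) G), (seriesPieces B 𝔖 Cp k).logFl h U =
      Real.log (∫ ω in (𝔖 k).box h, Real.exp ((𝔖 k).𝒱 h U ω) ∂(𝔖 k).μ) := fun _ _ => rfl
  have hPprU : ∀ (h : Hist S.P (k + 1)) (U : GaugeField S.P (k + 1) G), (seriesPieces B 𝔖 Cp k).PprU h U =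
      ∑ X ∈ Finset.univ.filter (fun X : (tsys 3 (𝔖 k).Nblk).Dom =>
        (tcubeSys 3 (𝔖 k).Nblk).cubes X ⊆ ΩblkOf (P := S.P) B.M₁ B.Rcol (Nc k) h ∧ (tsys 3 (𝔖 k).Nblk).dj X < B.Rret k),
          (𝔖 k).act h X U := fun _ _ => rfl
  exact cumulant58_of_graphRep23' (𝔖 k).Nblk (seriesPieces B 𝔖 Cp k) hκ (𝔖 k).Gt (𝔖 k).act hact
    (fun h U => ∫ ω in (𝔖 k).box h, Real.exp ((𝔖 k).𝒱 h U ω) ∂(𝔖 k).μ) c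
    (fun h => ΩblkOf (P := S.P) B.M₁ B.Rcol (Nc k) h) hG h25
    (fun h U => by rw [hlogFl h U, zero_mul, add_zero]) h324 hC₂ (le_of_eq hrem.symm) hR (mul_nonneg hC hg.le)
    (fun h U => by rw [hPprU h U, sum_filter_and_eq]) hZ hlarge

/-- **Row C4 `CumulantLower` AT `seriesPieces` FROM ONE `Eq324` ROW, AT AN ARBITRARY CUMULANT LETTER `c`** (one application of the lane's
`Cumulant59.cumulantLower_torus`, whose cumulant argument is free). [cite: Balaban1985UV3, (37) p.265 + p.272 + (59) p.270; Balaban1982Higgs1, (3.24) p.616] -/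
theorem cumulantLower_series_std_of_eq324_at (B : TowerBase S G) (𝔖 : ∀ k, StepSeries S G V (Nc k) k) (Cp : ∀ k, PiecesParams S k) (k : ℕ)
    [DecidableEq (tsys 3 (𝔖 k).Nblk).Dom] {κ C : ℝ}
    (hκ : kappa₀ (4 * 2 ^ 3) (2 * 3) + 1 ≤ κ) (hC : 0 ≤ C) {C₂₃ c₂₃ M₁ δ₀ : ℝ}
    (hact : ∀ h X U, ((𝔖 k).Gt h).activities.act X U = (𝔖 k).act h X U) {nbar : ℕ} {C₂ : ℝ}
    (c : Hist S.P (k + 1) → GaugeField S.P (k + 1) G → ℕ → ℝ)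
    (h324 : ∀ h (U : GaugeField S.P (k + 1) G),
      Eq324 (∫ ω in (𝔖 k).box h, Real.exp ((𝔖 k).𝒱 h U ω) ∂(𝔖 k).μ) (c h U) nbar C₂ ((L : ℝ) ^ k * S.g0sq) (3 + B.κ₀) (S.sites k))
    (hC₂ : 0 ≤ C₂) (hk : k ≤ S.K) (hκ₀ : 0 < B.κ₀) {r₀ R₁ : ℝ} (hr₀ : 1 ≤ r₀) (hR₁ : 6 + 2 * B.κ₀ ≤ R₁)
    (hrem : (Cp k).rem = ((L : ℝ) ^ k * S.g0sq) ^ (3 + B.κ₀) * S.sites k)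
    (hRret : B.Rret k = R₁ * B10.rFun r₀ (S.gk k))
    (hblocks : ((𝔖 k).Nblk : ℝ) ^ 3 ≤ S.sites k)
    (hG : ∀ h, GraphRep23AsCited ((𝔖 k).Gt h) (fun U => ∑ n ∈ Finset.Icc 1 nbar, c h U n / (n ! : ℝ)) C₂₃ c₂₃ M₁ δ₀)
    (h25 : ∀ h, B10.Bound25Printed
      ⟨(tsys 3 (𝔖 k).Nblk).Dom, GaugeField S.P (k + 1) G, (tsys 3 (𝔖 k).Nblk).dj, (𝔖 k).act h⟩ (S.gk k) κ C) :
    CumulantLower (seriesPieces B 𝔖 Cp k) (0 + C * K₀ (4 * 2 ^ 3) (2 * 3) * Real.exp (-R₁) + C₂) := by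
  have hZ : ∀ h, (((Finset.univ : Finset (tcubeSys 3 (𝔖 k).Nblk).Cube) \ ΩblkOf (P := S.P) B.M₁ B.Rcol (Nc k) h).card : ℝ)
      ≤ (seriesPieces B 𝔖 Cp k).Zvol h := fun h => by
    show _ ≤ ((ZVol B.M₁ B.Rcol (k + 1) h k : ℕ) : ℝ)
    exact_mod_cast card_compl_ΩblkOf_le_ZVol (P := S.P) B.M₁ B.Rcol (Nc k) h
  have hg : 0 < S.gk k := gk_pos S k
  have hg1 : S.gk k ≤ 1 := gk_le_one S S.gK_le_one k hk
  have hK₀ : 0 ≤ K₀ (4 * 2 ^ 3) (2 * 3) := (B12TreeDecay.K₀_pos _ _).le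
  have hR : 0 ≤ B.Rret k := by
    rw [hRret]; exact mul_nonneg (by linarith) (VacuumAndBooking.rFun_nonneg r₀ (S.gk k) hg hg1)
  have hlarge : (C * S.gk k * K₀ (4 * 2 ^ 3) (2 * 3) * ((𝔖 k).Nblk : ℝ) ^ 3) * Real.exp (-B.Rret k) ≤
      (C * K₀ (4 * 2 ^ 3) (2 * 3) * Real.exp (-R₁)) * (Cp k).rem := by
    have h := largeLoc_le_normRem S (r₀ := r₀) (R₁ := R₁) (κ₀ := B.κ₀) (A := C * K₀ (4 * 2 ^ 3) (2 * 3))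
      (vol := ((𝔖 k).Nblk : ℝ) ^ 3) k hk hr₀ (by linarith) (by linarith) (mul_nonneg hC hK₀) (by positivity) hblocks
    rw [hRret, hrem, ScalesArithmetic.norm_rem_eq]
    calc C * S.gk k * K₀ (4 * 2 ^ 3) (2 * 3) * ((𝔖 k).Nblk : ℝ) ^ 3 * Real.exp (-(R₁ * B10.rFun r₀ (S.gk k)))
        = C * K₀ (4 * 2 ^ 3) (2 * 3) * S.gk k * ((𝔖 k).Nblk : ℝ) ^ 3 * Real.exp (-(R₁ * B10.rFun r₀ (S.gk k))) := by
          ring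
      _ ≤ C * K₀ (4 * 2 ^ 3) (2 * 3) * Real.exp (-R₁) * ((S.gk k ^ 2) ^ (3 + B.κ₀) * S.sites k) := h
  have hlogFl : ∀ (h : Hist S.P (k + 1)) (U : GaugeField S.P (k + 1) G), (seriesPieces B 𝔖 Cp k).logFl h U =
      Real.log (∫ ω in (𝔖 k).box h, Real.exp ((𝔖 k).𝒱 h U ω) ∂(𝔖 k).μ) := fun _ _ => rfl
  have hPprU : ∀ (h : Hist S.P (k + 1)) (U : GaugeField S.P (k + 1) G), (seriesPieces B 𝔖 Cp k).PprU h U =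
      ∑ X ∈ Finset.univ.filter (fun X : (tsys 3 (𝔖 k).Nblk).Dom =>
        (tcubeSys 3 (𝔖 k).Nblk).cubes X ⊆ ΩblkOf (P := S.P) B.M₁ B.Rcol (Nc k) h ∧ (tsys 3 (𝔖 k).Nblk).dj X < B.Rret k),
          (𝔖 k).act h X U := fun _ _ => rfl
  exact cumulantLower_torus (𝔖 k).Nblk (seriesPieces B 𝔖 Cp k) hκ
    (fun h U => ∫ ω in (𝔖 k).box h, Real.exp ((𝔖 k).𝒱 h U ω) ∂(𝔖 k).μ) c (𝔖 k).act
    (fun h => ΩblkOf (P := S.P) B.M₁ B.Rcol (Nc k) h)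
    (fun U => by rw [hlogFl, zero_mul, sub_zero]) (fun U => h324 _ U) hC₂ (le_of_eq hrem.symm) hR (mul_nonneg hC hg.le) h25
    (fun h U => by rw [(hG h).cum_eq_sum_activities U]; exact Finset.sum_congr rfl fun X _ => hact h X U)
    (fun h U => by rw [hPprU h U, sum_filter_and_eq]) hZ hlarge

end SeriesAt
section PiecesAt

variable (𝔎 : LaneConsts L) {S : Scales L} {G : Type} [GaugeGroup G] [MeasurableSpace G] [HaarData G]
  {V : Type} [NormedAddCommGroup V] [NormedSpace ℂ V]
  (X : ExternalInputs S G) (𝔖 : ∀ k, StepSeries S G V (nblkOf S 𝔎.carrier k) k) (k : ℕ)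

open Classical in
/-- **Row C3 AT THE LANE'S PIECES from ONE `Eq324` row, at an arbitrary cumulant letter `c`** (gen 0's `…RowSuppliers.cumulant58_pieces_of_eq324_core` with
`(𝔖 k).cum ↦ c`). [cite: Balaban1985UV3, (24) p.262 + (58)–(59) p.270] -/
theorem cumulant58_pieces_of_eq324_at (hk : k + 1 ≤ S.K) {κ C25 : ℝ}
    (hκ : kappa₀ (4 * 2 ^ 3) (2 * 3) + 1 ≤ κ) (hC25 : 0 ≤ C25) (hr₀ : 1 ≤ 𝔎.F.r₀) (hR₁ : 6 + 2 * 𝔎.F.κ₀ ≤ 𝔎.F.R₁)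
    {C₂₃ c₂₃ M₁ δ₀ : ℝ} {nbar : ℕ} {C₂ : ℝ} (hC₂ : 0 ≤ C₂)
    (hCz : 𝔎.sc.Cz = C25 * K₀ (4 * 2 ^ 3) (2 * 3))
    (hC₁ : 𝔎.sc.C₁ = 0 + C25 * K₀ (4 * 2 ^ 3) (2 * 3) * Real.exp (-𝔎.F.R₁) + C₂)
    (hact : ∀ h Y U, ((𝔖 k).Gt h).activities.act Y U = (𝔖 k).act h Y U)
    (c : Hist S.P (k + 1) → GaugeField S.P (k + 1) G → ℕ → ℝ)
    (h324 : ∀ h (U : GaugeField S.P (k + 1) G),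
      Eq324 (∫ ω in (𝔖 k).box h, Real.exp ((𝔖 k).𝒱 h U ω) ∂(𝔖 k).μ) (c h U) nbar C₂ ((L : ℝ) ^ k * S.g0sq) (3 + 𝔎.F.κ₀) (S.sites k))
    (hG : ∀ h, GraphRep23AsCited ((𝔖 k).Gt h) (fun U => ∑ n ∈ Finset.Icc 1 nbar, c h U n / (n ! : ℝ)) C₂₃ c₂₃ M₁ δ₀)
    (h25 : ∀ h, Bound25Printed ⟨(tsys 3 (𝔖 k).Nblk).Dom, GaugeField S.P (k + 1) G, (tsys 3 (𝔖 k).Nblk).dj, (𝔖 k).act h⟩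
      (S.gk k) κ C25) :
    Cumulant58 (pieces 𝔎 X 𝔖 k) 𝔎.sc.Cz 𝔎.sc.C₁ := by
  rw [hCz, hC₁]
  exact cumulant58_series_std_of_eq324_at (X.toTowerBase 𝔎.carrier) 𝔖 (piecesParamsOf S 𝔎.carrier) k hκ hC25 hact c h324 hC₂ (by omega)
    𝔎.F.κ₀_pos hr₀ hR₁ (AlphaCumulant.rem_pieces 𝔎 X k) rfl (nblk_cube_le_sites 𝔎 k (by omega)) hG h25

open Classical in
/-- **Row C4 AT THE LANE'S PIECES from ONE `Eq324` row, at an arbitrary cumulant letter `c`** (gen 0's `…RowSuppliers.cumulantLower_pieces_of_eq324_core`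
with `(𝔖 k).cum ↦ c`). [cite: Balaban1985UV3, (37) p.265 + p.272 + (59) p.270] -/
theorem cumulantLower_pieces_of_eq324_at (hk : k + 1 ≤ S.K) {κ C25 : ℝ}
    (hκ : kappa₀ (4 * 2 ^ 3) (2 * 3) + 1 ≤ κ) (hC25 : 0 ≤ C25) (hr₀ : 1 ≤ 𝔎.F.r₀) (hR₁ : 6 + 2 * 𝔎.F.κ₀ ≤ 𝔎.F.R₁)
    {C₂₃ c₂₃ M₁ δ₀ : ℝ} {nbar : ℕ} {C₂ : ℝ} (hC₂ : 0 ≤ C₂)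
    (hC₁' : 𝔎.sc.C₁' = 0 + C25 * K₀ (4 * 2 ^ 3) (2 * 3) * Real.exp (-𝔎.F.R₁) + C₂)
    (hact : ∀ h Y U, ((𝔖 k).Gt h).activities.act Y U = (𝔖 k).act h Y U)
    (c : Hist S.P (k + 1) → GaugeField S.P (k + 1) G → ℕ → ℝ)
    (h324 : ∀ h (U : GaugeField S.P (k + 1) G),
      Eq324 (∫ ω in (𝔖 k).box h, Real.exp ((𝔖 k).𝒱 h U ω) ∂(𝔖 k).μ) (c h U) nbar C₂ ((L : ℝ) ^ k * S.g0sq) (3 + 𝔎.F.κ₀) (S.sites k))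
    (hG : ∀ h, GraphRep23AsCited ((𝔖 k).Gt h) (fun U => ∑ n ∈ Finset.Icc 1 nbar, c h U n / (n ! : ℝ)) C₂₃ c₂₃ M₁ δ₀)
    (h25 : ∀ h, Bound25Printed ⟨(tsys 3 (𝔖 k).Nblk).Dom, GaugeField S.P (k + 1) G, (tsys 3 (𝔖 k).Nblk).dj, (𝔖 k).act h⟩
      (S.gk k) κ C25) :
    CumulantLower (pieces 𝔎 X 𝔖 k) 𝔎.sc.C₁' := by
  rw [hC₁']
  exact cumulantLower_series_std_of_eq324_at (X.toTowerBase 𝔎.carrier) 𝔖 (piecesParamsOf S 𝔎.carrier) k hκ hC25 hact c h324 hC₂ (by omega)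
    𝔎.F.κ₀_pos hr₀ hR₁ (AlphaCumulant.rem_pieces 𝔎 X k) rfl (nblk_cube_le_sites 𝔎 k (by omega)) hG h25

end PiecesAt

/-! ## §2 The re-lettered range-honest core clause and its equivalence with the landed one at the lane's letter -/
section Alpha

variable {S : Scales L} {G : Type} [GaugeGroup G] [MeasurableSpace G] [HaarData G] (𝔊 : GroupModel G) (𝔠 : AlphaConsts L 𝔊.N)
  (X : ExternalInputs S G) (𝔖 : ∀ k, StepSeries S G ↥(lieC 𝔊) (nblkOf S 𝔠.lane.carrier k) k) (𝔄 : AlphaDataLT 𝔊 𝔠 X 𝔖)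
  (c : ∀ k, Hist S.P (k + 1) → GaugeField S.P (k + 1) G → ℕ → ℝ)

open Classical in
/-- **THE RANGE-HONEST CORE (α) INPUTS OF STEP `k → k+1`, `k < K`, AT THE CUMULANT LETTER `c`** — gen 0's `…RowRange.StepAlphaEq324CoreLT k hk` row for row,
except that the G3D-02 row `hG` and the (3.24) row `h324` read the cumulant function `c k h U : ℕ → ℝ` instead of the lane's χ-weighted `(𝔖 k).cum h U`.
HYPOTHESES; nothing asserted. [cite: Balaban1985UV3, (23)–(33) pp.262–264 + (44) p.267 + (55)–(63) pp.269–272; Balaban1982Higgs1, (3.24) p.616] -/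
structure StepAlphaEq324CoreLTAt (k : ℕ) (hk : k + 1 ≤ S.K) : Prop where
  /-- G3D-01 at the (25)-rate (R-ACT) -/
  chart : ∀ Y, ChartAnalyticityAsCited ((𝔖 k).Ψ Y) 𝔠.ρ
    (𝔠.C25 * S.gk k * Real.exp (-(𝔠.κ * (tsys 3 (nblkOf S 𝔠.lane.carrier k)).dj Y)))
  /-- (28) p. 263 -/
  bound28 : ∀ Y h U, ‖(𝔖 k).Bcfg Y h U‖ ≤ 𝔠.cB * (rFun 𝔠.r₀ (S.gk k) * S.gk k * pFun 𝔠.b₀ 𝔠.p₀ (S.gk k))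
  /-- (26) in the chart space, for the adjoint action -/
  inv26 : ∀ Y (U : G), ∀ b ∈ ball (0 : (𝔖 k).E) 𝔠.ρ, adjAct 𝔊 (P := S.P) k U b ∈ ball (0 : (𝔖 k).E) 𝔠.ρ →
    (𝔖 k).Ψ Y (adjAct 𝔊 (P := S.P) k U b) = (𝔖 k).Ψ Y b
  /-- G3D-06 -/
  far_le : FarTermsDecayAsCited (𝔖 k).far
    (fun Y => 𝔠.C25 * S.gk k * Real.exp (-(𝔠.κ * (tsys 3 (nblkOf S 𝔠.lane.carrier k)).dj Y)))
    𝔠.Cfar (S.gk k ^ 7 * (rFun 𝔠.r₀ (S.gk k) * pFun 𝔠.b₀ 𝔠.p₀ (S.gk k)) ^ 7)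
  /-- identification of `PY` with the retained jet -/
  hPY : ∀ h U, (𝔖 k).PY h U
    = ∑ Y ∈ (𝔖 k).loc (ΩblkOf 𝔠.lane.carrier.M₁ (rcolOf S 𝔠.lane.carrier) (nblkOf S 𝔠.lane.carrier k)) (rretOf S 𝔠.lane.carrier k) h,
        ((jet26 ((𝔖 k).Ψ Y) ((𝔖 k).Bcfg Y h U)).re - (𝔖 k).far Y h U)
  /-- identification of `PYZ` with the retained jet of the G3D-07 pieces at this run step -/
  hPYZ : ∀ h U, (𝔖 k).PYZ h U
    = ∑ Y ∈ (𝔖 k).loc (ΩblkOf 𝔠.lane.carrier.M₁ (rcolOf S 𝔠.lane.carrier) (nblkOf S 𝔠.lane.carrier k)) (rretOf S 𝔠.lane.carrier k) h,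
        ((jet26 ((𝔄.Λc k hk).Ψ Y) ((𝔖 k).Bcfg Y h U)).re - (𝔄.Λc k hk).far Y h U)
  /-- G3D-04 -/
  norm35 : Norm35StepAsCited (pieces 𝔠.lane X 𝔖 k) 𝔠.c35 𝔠.a35 𝔠.cv 𝔠.cJ35
  /-- G3D-05 -/
  logZT : LogZTExtensiveAsCited (pieces 𝔠.lane X 𝔖 k) 𝔠.cT 𝔠.aT 𝔠.cn 𝔠.cJT
  /-- R-ACT -/
  hact : ∀ h Y U, ((𝔖 k).Gt h).activities.act Y U = (𝔖 k).act h Y U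
  /-- G3D-02, the graph terms representing `Σ_{n≤n̄} c k h U n ∕ n!` -/
  hG : ∀ h, GraphRep23AsCited ((𝔖 k).Gt h) (fun U => ∑ n ∈ Finset.Icc 1 𝔠.nbar, c k h U n / (n.factorial : ℝ))
    (𝔄.C₂₃ k) (𝔄.c₂₃ k) (𝔄.M₂₃ k) (𝔄.δ₀ k)
  /-- [B1] (3.24) AS PRINTED for the step's fluctuation integral over the small-field box, with the cumulants `c k h U` -/
  h324 : ∀ h (U : GaugeField S.P (k + 1) G),
    Eq324 (∫ ω in (𝔖 k).box h, Real.exp ((𝔖 k).𝒱 h U ω) ∂(𝔖 k).μ) (c k h U) 𝔠.nbar (𝔠.Ca + 𝔠.Cc)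
      ((L : ℝ) ^ k * S.g0sq) (3 + 𝔠.κ₀) (S.sites k)
  /-- (44) p. 267 on the previous-scale terms of the data -/
  h44 : ∀ (h : Hist S.P (k + 1)) (U : GaugeField S.P (k + 1) G), ∀ j ∈ Finset.Icc 1 k,
    Bound44 (oldGeom S.P k j) (fun y n c' => (𝔖 k).oldVal h U j y n c') 𝔠.κ₁ (𝔠.M₁ : ℝ) (ell S.P k j) (L : ℝ) 𝔠.B₃
      (S.gk k) (pFun 𝔠.b₀ 𝔠.p₀ (S.gk k)) 𝔠.C44
  /-- the degree floor «n ≥ 2» of (43) -/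
  hfloor : ∀ (h : Hist S.P (k + 1)) (U : GaugeField S.P (k + 1) G), ∀ j ∈ Finset.Icc 1 k,
    ∀ (y : Site S.P j) (n : ℕ) (c' : Fin n → PBond S.P j), (𝔖 k).oldVal h U j y n c' ≠ 0 → 2 ≤ n
  /-- EXTERNAL-input property ([7] Thm 1): `U_k(·, h)` measurable -/
  hU : ∀ h : Hist S.P k, Measurable (X.UkH k h)
  /-- `Pint k h` measurable … -/
  hPm : ∀ h : Hist S.P k, Measurable ((inputOf 𝔠.lane X 𝔖).Pint k h)
  /-- … and bounded above -/
  hPb : ∀ (h : Hist S.P k) (U : GaugeField S.P k G), (inputOf 𝔠.lane X 𝔖).Pint k h U ≤ 𝔄.cP k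
  /-- RESIDUAL R3D-01 (p4) -/
  fibre49 : ∀ h' : Hist S.P (k + 1), Fibre49 X 𝔠.lane.carrier 𝔖 (fun _ => True) k (piecesW 𝔠.lane X 𝔖 k) h'
  /-- RESIDUAL R3D-02 (p4) -/
  fibre57Low : Fibre57Low X 𝔠.lane.carrier 𝔖 (fun _ => True) k (piecesW 𝔠.lane X 𝔖 k)

/-- **THE RANGE-HONEST CORE (α) CLAUSE OF ONE LATTICE APPROXIMATION AT THE CUMULANT LETTER `c`**: the re-lettered core step inputs at every run step
`k < K` + the two B25 displays (67)∘LF, (68) (verbatim).  HYPOTHESES. [cite: Balaban1985UV3, (67)–(68) p.273 + pp.273–274] -/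
structure RunAlphaEq324CoreLTAt : Prop where
  /-- the re-lettered core step inputs, keyed on the run step -/
  steps : ∀ k (hk : k + 1 ≤ S.K), StepAlphaEq324CoreLTAt 𝔊 𝔠 X 𝔖 𝔄 c k hk
  /-- (67) ∘ the large-field characteristic function of the history, on the averaged lifted minimizers -/
  hLF67 : ∀ k, k ≤ S.K → ∀ (h : Hist S.P k), Hist.Admissible 𝔠.lane.carrier.M₁ (rcolOf S 𝔠.lane.carrier) k h →
    ∀ (U : GaugeField S.P k G), ∀ e ∈ Hist.disc h, S.gk e.1 * pFun 𝔠.lane.carrier.b₀ 𝔠.lane.carrier.p₀ (S.gk e.1) ≤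
      ‖((hol (avgIter L (liftCfg 𝔊 (X.UkH k h U)) e.1) (codeZ e) (plaqWord e.2.2.1 e.2.2.2) :
          (Matrix (Fin 𝔊.N) (Fin 𝔊.N) ℂ)ˣ) : Matrix (Fin 𝔊.N) (Fin 𝔊.N) ℂ) - 1‖
  /-- (68) on the lifted minimizers -/
  h68 : ∀ k, k ≤ S.K → ∀ (h : Hist S.P k), Hist.Admissible 𝔠.lane.carrier.M₁ (rcolOf S 𝔠.lane.carrier) k h →
    ∀ (U : GaugeField S.P k G), ∀ e ∈ Hist.disc h,
      pdevOn (loK L e.1 (codeZ e)) (plaqHiK L e.1 (codeZ e) e.2.2.1 e.2.2.2) (liftCfg 𝔊 (X.UkH k h U)) <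
        𝔠.C68 * (S.gk e.1 * pFun 𝔠.lane.carrier.b₀ 𝔠.lane.carrier.p₀ (S.gk e.1)) * (((L : ℝ) ^ e.1)⁻¹) ^ 2

end Alpha

section Letter

variable {S : Scales L} {G : Type} [GaugeGroup G] [MeasurableSpace G] [HaarData G] {𝔊 : GroupModel G} {𝔠 : AlphaConsts L 𝔊.N}
  {X : ExternalInputs S G} {𝔖 : ∀ k, StepSeries S G ↥(lieC 𝔊) (nblkOf S 𝔠.lane.carrier k) k} {𝔄 : AlphaDataLT 𝔊 𝔠 X 𝔖}

/-- **AT THE LANE'S LETTER `c := (𝔖 ·).cum` THE RE-LETTERED STEP LIST IS THE LANDED ONE**: `StepAlphaEq324CoreLTAt … (fun k => (𝔖 k).cum) k hk ↔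
StepAlphaEq324CoreLT … k hk`, row for row. [cite: Balaban1985UV3, (58) p.270 (bookkeeping)] -/
theorem stepCoreLTAt_cum_iff {k : ℕ} {hk : k + 1 ≤ S.K} :
    StepAlphaEq324CoreLTAt 𝔊 𝔠 X 𝔖 𝔄 (fun k => (𝔖 k).cum) k hk ↔ StepAlphaEq324CoreLT 𝔊 𝔠 X 𝔖 𝔄 k hk := by
  constructor
  · intro A
    exact
    { chart := A.chart, bound28 := A.bound28, inv26 := A.inv26, far_le := A.far_le, hPY := A.hPY, hPYZ := A.hPYZ, norm35 := A.norm35,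
      logZT := A.logZT, hact := A.hact, hG := A.hG, h324 := A.h324, h44 := A.h44, hfloor := A.hfloor, hU := A.hU, hPm := A.hPm, hPb := A.hPb,
      fibre49 := A.fibre49, fibre57Low := A.fibre57Low }
  · intro A
    exact
    { chart := A.chart, bound28 := A.bound28, inv26 := A.inv26, far_le := A.far_le, hPY := A.hPY, hPYZ := A.hPYZ, norm35 := A.norm35,
      logZT := A.logZT, hact := A.hact, hG := A.hG, h324 := A.h324, h44 := A.h44, hfloor := A.hfloor, hU := A.hU, hPm := A.hPm, hPb := A.hPb,
      fibre49 := A.fibre49, fibre57Low := A.fibre57Low }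

/-- **… and so is the run clause**: `RunAlphaEq324CoreLTAt … (fun k => (𝔖 k).cum) ↔ RunAlphaEq324CoreLT …`. [cite: Balaban1985UV3, (67)–(68) p.273 (bookkeeping)] -/
theorem coreLTAt_cum_iff : RunAlphaEq324CoreLTAt 𝔊 𝔠 X 𝔖 𝔄 (fun k => (𝔖 k).cum) ↔ RunAlphaEq324CoreLT 𝔊 𝔠 X 𝔖 𝔄 := by
  constructor
  · intro R
    exact { steps := fun k hk => stepCoreLTAt_cum_iff.1 (R.steps k hk), hLF67 := R.hLF67, h68 := R.h68 }
  · intro R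
    exact { steps := fun k hk => stepCoreLTAt_cum_iff.2 (R.steps k hk), hLF67 := R.hLF67, h68 := R.h68 }

/-- **The landed range-honest core clause is the instance `c := (𝔖 ·).cum` of the re-lettered one** (so every inhabitant of the former — gen 0's
`…RowRangeZero` witnesses, the lane's clause through `…RowRange.coreLT_of_runAlpha` — inhabits the latter). [cite: Balaban1985UV3, (67)–(68) p.273 (bookkeeping)] -/
theorem coreLTAt_cum_of_coreLT (R : RunAlphaEq324CoreLT 𝔊 𝔠 X 𝔖 𝔄) : RunAlphaEq324CoreLTAt 𝔊 𝔠 X 𝔖 𝔄 (fun k => (𝔖 k).cum) :=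
  coreLTAt_cum_iff.2 R

/-- **… in particular the lane's CURRENT (α) clause `UVStability3DInputs.RunAlpha` gives the re-lettered clause at `c := (𝔖 ·).cum`** over the restricted bundle.
[cite: Balaban1985UV3, (67)–(68) p.273 (bookkeeping)] -/
theorem coreLTAt_cum_of_runAlpha {𝔄 : AlphaData 𝔊 𝔠 X 𝔖} (R : RunAlpha 𝔊 𝔠 X 𝔖 𝔄) :
    RunAlphaEq324CoreLTAt 𝔊 𝔠 X 𝔖 (restrictLT 𝔄) (fun k => (𝔖 k).cum) :=
  coreLTAt_cum_of_coreLT (coreLT_of_runAlpha R)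

/-- **CHANGING THE LETTER ON A NULL SET OF ORDERS IS FREE**: two letters that agree on `Icc 1 n̄` at every `(k, h, U)` give the same clause (both rows read only
`Σ_{n ∈ Icc 1 n̄} c k h U n ∕ n!`). [cite: Balaban1985UV3, (58) p.270 (bookkeeping)] -/
theorem stepCoreLTAt_congr {c c' : ∀ k, Hist S.P (k + 1) → GaugeField S.P (k + 1) G → ℕ → ℝ} {k : ℕ} {hk : k + 1 ≤ S.K}
    (hcc' : ∀ h U, ∀ n ∈ Finset.Icc 1 𝔠.nbar, c' k h U n = c k h U n) (A : StepAlphaEq324CoreLTAt 𝔊 𝔠 X 𝔖 𝔄 c k hk) :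
    StepAlphaEq324CoreLTAt 𝔊 𝔠 X 𝔖 𝔄 c' k hk := by
  have hsum : ∀ h U, ∑ n ∈ Finset.Icc 1 𝔠.nbar, c' k h U n / (n.factorial : ℝ) = ∑ n ∈ Finset.Icc 1 𝔠.nbar, c k h U n / (n.factorial : ℝ) :=
    fun h U => Finset.sum_congr rfl fun n hn => by rw [hcc' h U n hn]
  exact
  { chart := A.chart, bound28 := A.bound28, inv26 := A.inv26, far_le := A.far_le, hPY := A.hPY, hPYZ := A.hPYZ, norm35 := A.norm35,
    logZT := A.logZT, hact := A.hact,
    hG := fun h => by simpa only [hsum h] using A.hG h,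
    h324 := fun h U => BalabanUVNodesN08AlphaEq324RowSocket.eq324_congr_cum (A.h324 h U) (hcc' h U),
    h44 := A.h44, hfloor := A.hfloor, hU := A.hU, hPm := A.hPm, hPb := A.hPb, fibre49 := A.fibre49, fibre57Low := A.fibre57Low }

end Letter

/-! ## §3 The supplier socket at the letter -/
section Socket

variable {S : Scales L} {G : Type} [GaugeGroup G] [MeasurableSpace G] [HaarData G] (𝔊 : GroupModel G) (𝔠 : AlphaConsts L 𝔊.N)
  (𝔖 : ∀ k, StepSeries S G ↥(lieC 𝔊) (nblkOf S 𝔠.lane.carrier k) k) (k : ℕ)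
  (c : Hist S.P (k + 1) → GaugeField S.P (k + 1) G → ℕ → ℝ)

/-- ★ **THE RE-LETTERED (3.24) ROW FROM A SANDWICH SUPPLIER**: if for every `(h, U)` the step's box fluctuation integral is positive and
`|log ∫_{box h} e^{𝒱 h U} dμ − Σ_{n=1}^{n̄} c h U n∕n!| ≤ E h U ≤ (Ca + Cc)·(Lᵏg₀²)^{3+κ₀}·|T₁^{(k)}|`, then the row `StepAlphaEq324CoreLTAt.h324` at the letter `c`
holds — the plug for the [2]-road's conclusions `|log ∫ Πχ̂ e^{H} dμ_G − Σ_{n≤t} ℰ_Gᵀ(H; n)∕n!| ≤ |I|·errTerm …`, whose cumulants are the FREE ones.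
[cite: Balaban1982Higgs1, (3.24) p.616; BenfattoEtAl1978, (4.6)–(4.7) p.152; Balaban1985UV3, (58) p.270] -/
theorem h324RowAt_of_abs_log_le (E : Hist S.P (k + 1) → GaugeField S.P (k + 1) G → ℝ)
    (hpos : ∀ h (U : GaugeField S.P (k + 1) G), 0 < ∫ ω in (𝔖 k).box h, Real.exp ((𝔖 k).𝒱 h U ω) ∂(𝔖 k).μ)
    (hsand : ∀ h (U : GaugeField S.P (k + 1) G),
      |Real.log (∫ ω in (𝔖 k).box h, Real.exp ((𝔖 k).𝒱 h U ω) ∂(𝔖 k).μ) - ∑ n ∈ Finset.Icc 1 𝔠.nbar, c h U n / (n ! : ℝ)| ≤ E h U)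
    (hE : ∀ h (U : GaugeField S.P (k + 1) G), E h U ≤ (𝔠.Ca + 𝔠.Cc) * ((L : ℝ) ^ k * S.g0sq) ^ (3 + 𝔠.κ₀) * S.sites k) :
    ∀ h (U : GaugeField S.P (k + 1) G),
      Eq324 (∫ ω in (𝔖 k).box h, Real.exp ((𝔖 k).𝒱 h U ω) ∂(𝔖 k).μ) (c h U) 𝔠.nbar (𝔠.Ca + 𝔠.Cc)
        ((L : ℝ) ^ k * S.g0sq) (3 + 𝔠.κ₀) (S.sites k) :=
  fun h U => eq324_of_abs_log_le (hpos h U) (hsand h U) (hE h U)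

/-- **THE RE-LETTERED (3.24) ROW FROM ANY `Eq324` AT THE LETTER WITH A SMALLER BUDGET** (bound weakening `eq324_mono`).
[cite: Balaban1982Higgs1, (3.24) p.616; Balaban1985UV3, (58) p.270] -/
theorem h324RowAt_of_eq324_le (C' : Hist S.P (k + 1) → GaugeField S.P (k + 1) G → ℝ) (s' κ' vol' : ℝ)
    (h324' : ∀ h (U : GaugeField S.P (k + 1) G),
      Eq324 (∫ ω in (𝔖 k).box h, Real.exp ((𝔖 k).𝒱 h U ω) ∂(𝔖 k).μ) (c h U) 𝔠.nbar (C' h U) s' κ' vol')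
    (hle : ∀ h (U : GaugeField S.P (k + 1) G), C' h U * s' ^ κ' * vol' ≤ (𝔠.Ca + 𝔠.Cc) * ((L : ℝ) ^ k * S.g0sq) ^ (3 + 𝔠.κ₀) * S.sites k) :
    ∀ h (U : GaugeField S.P (k + 1) G),
      Eq324 (∫ ω in (𝔖 k).box h, Real.exp ((𝔖 k).𝒱 h U ω) ∂(𝔖 k).μ) (c h U) 𝔠.nbar (𝔠.Ca + 𝔠.Cc)
        ((L : ℝ) ^ k * S.g0sq) (3 + 𝔠.κ₀) (S.sites k) :=
  fun h U => eq324_mono (h324' h U) (hle h U)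

end Socket

end Summit.QuantumFields.YangMills.Theorems.BalabanUVNodesN08AlphaEq324RowCumLetter

end
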